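import Mathlib

/-!
# BlochSeedDiscOne ∕ LINE 12 «COMMON-SLOPE LAW» — first-order Weil rigidity of the FRAME on the UP road
(negation lens `plan-lens-HodgeAV-negation` g11; evidence-only on `stmt-HodgeConjecture-18881`
`EightfoldBlochSeeds.BlochSeedDiscOne`; skeleton `Cruxes/BlochSeedDiscOne/Lines/birth.lean` 814a6a70c14e831a UNTOUCHED)

HONEST FRAMING. Mathlib-only kernel companion of the crux-idea card `Ideas/common-slope-law.md`. NOTHING HERE SAYS THAT
HC ∕ HC_CM ∕ HC_AV ∕ H2 ∕ 18881 ∕ №4 ∕ 26512 HOLDS OR FAILS; HC_CM is a displayed binder of the route and is not used; no variety,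
sheaf, Atiyah class or semiregularity map is constructed; no `sorry`, no `axiom`, no `instance`, no notation, no Literature fact.
What the kernel checks is (§1) the DEGREE-ONE WEIL RIGIDITY LEMMA at the CM point in matrix form, (§2) the abstract lifting
algebra that turns the UP-ROAD LIFTING CRITERION into the class rows «SLOPE MATCH» and «COMMON SLOPE», (§3) the integrality
dichotomy (`3μ` integral; `μ` integral when `3 ∤ m`) and the arithmetic of the verdicts. The GEOMETRIC inputs are PEN and live
in the card (§2 there): Bloch's `π ∘ ρ_Z(κ) = κ ∪ [Z]` [Blo72], the General Frame Sequence of LINE 11 (pen ×2, idea-crit-6 g13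
bus l.8046 (B)), the naturality square `∂ ∘ ρ_Z = ob(ℙV → X)|_{Z̃}`, the zero-locus obstruction lemma on `ℙ(V)` in the Serre
regime, and twist bookkeeping. They are NOT formalised here.

DICTIONARY (card §1–§2). `X₀ = E_i^8`, coordinates `z₁…z₈`, `K = ℚ(i)` acting by `i` on `z₁…z₄` and `−i` on `z₅…z₈`;
`V_K = ⟨dz₁,…,dz₄, dz̄₅,…,dz̄₈⟩`, Weil plane `W ⊗ ℂ = Λ⁸V_K ⊕ Λ⁸V̄_K`. A first-order deformation of `X₀` preserving the
principal polarisation `h = Σ dz_a dz̄_a` is a SYMMETRIC matrix `ξ ∈ M₈(ℂ)` (`dz_a ↦ Σ_b ξ_{ab} dz̄_b`); it preserves the two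
Weil classes iff its diagonal `4 × 4` blocks vanish, i.e. `ξ = weilDir M = [[0, M], [Mᵀ, 0]]`, `M ∈ M₄(ℂ)` arbitrary — the
SIXTEEN Weil directions `T_W ≅ M₄(ℂ)` (= the cell's `T_W`, `Pad4FirstOrderModel` §THE MODEL). A `(1,1)`-class with Gram matrix
`c` (`Σ c_{ab} dz_a dz̄_b`) has first-order derivative `ξ(c) = Σ c_{ab} ξ_{ad} dz̄_d ∧ dz̄_b`, which vanishes iff `ξᵀ c` is
symmetric, i.e. (ξ symmetric) iff `ξ c = cᵀ ξ` — the predicate `Killed ξ c` below. THEOREM `weilRigid_deg1`: a class killed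
by all sixteen Weil directions is a scalar multiple of `h` (over any commutative ring; no Hermitian hypothesis needed). This is
the `k = 1` case of the Weil rigidity used in the card («a rational `(k,k)`-class on `X₀` that stays `(k,k)` to first order
along `T_W` lies in `ℚh^k`, resp. `ℚh⁴ ⊕ W_ℚ` for `k = 4`», pen via `𝔭⁺, 𝔭⁻` generating `𝔰𝔩₈`); only `k = 1` is
load-bearing for the slope rows and only `k = 1` is kernel-checked.
-/

set_option linter.dupNamespace false

namespace Summit.HodgeConjecture.HodgeConjecture.Cruxes.BlochSeedDiscOne.CommonSlopeLaw

/-! ## §1 Degree-one Weil rigidity at the CM point (kernel) -/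

section WeilRigidity

variable {R : Type*} [CommRing R]

/-- the Weil tangent direction attached to `M ∈ M₄(R)`: the symmetric `8 × 8` matrix `[[0, M], [Mᵀ, 0]]`
(blocks = factors `1…4` ∕ `5…8`). [definition of this file; dictionary in the module docstring] -/
def weilDir (M : Matrix (Fin 4) (Fin 4) R) : Matrix (Fin 4 ⊕ Fin 4) (Fin 4 ⊕ Fin 4) R :=
  Matrix.fromBlocks 0 M M.transpose 0

/-- «the first-order derivative of the `(1,1)`-class with Gram matrix `c` along the symmetric direction `ξ` vanishes»:
`ξ c = cᵀ ξ`. [definition of this file] -/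
def Killed (ξ c : Matrix (Fin 4 ⊕ Fin 4) (Fin 4 ⊕ Fin 4) R) : Prop := ξ * c = c.transpose * ξ

/-- Weil directions are polarisation-preserving (symmetric). -/
theorem weilDir_transpose (M : Matrix (Fin 4) (Fin 4) R) : (weilDir M).transpose = weilDir M := by
  simp [weilDir, Matrix.fromBlocks_transpose]

/-- sanity: the polarisation class itself (`c = l • 1`) is killed by every Weil direction. -/
theorem killed_weilDir_scalar (M : Matrix (Fin 4) (Fin 4) R) (l : R) : Killed (weilDir M) (l • 1) := by
  simp [Killed, Matrix.transpose_smul, Matrix.transpose_one]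

/-- the four block equations of `Killed (weilDir M) [[A,B],[C,D]]`. -/
theorem killed_weilDir_iff (M A B C D : Matrix (Fin 4) (Fin 4) R) :
    Killed (weilDir M) (Matrix.fromBlocks A B C D) ↔
      M * C = C.transpose * M.transpose ∧ M * D = A.transpose * M ∧
        M.transpose * A = D.transpose * M.transpose ∧ M.transpose * B = B.transpose * M := by
  simp only [Killed, weilDir, Matrix.fromBlocks_transpose, Matrix.fromBlocks_multiply, Matrix.zero_mul,
    Matrix.mul_zero, zero_add, add_zero, Matrix.fromBlocks_inj]

/-- entries of `E_{jk} N`. -/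
private theorem single_mul_entry (j k : Fin 4) (N : Matrix (Fin 4) (Fin 4) R) (x y : Fin 4) :
    (Matrix.single j k (1 : R) * N) x y = if x = j then N k y else 0 := by
  split_ifs with hx
  · subst hx; simp [Matrix.single_mul_apply_same]
  · simp [Matrix.single_mul_apply_of_ne, hx]

/-- entries of `N E_{jk}`. -/
private theorem mul_single_entry (j k : Fin 4) (N : Matrix (Fin 4) (Fin 4) R) (x y : Fin 4) :
    (N * Matrix.single j k (1 : R)) x y = if y = k then N x j else 0 := by
  split_ifs with hy
  · subst hy; simp [Matrix.mul_single_apply_same]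
  · simp [Matrix.mul_single_apply_of_ne, hy]

private theorem exists_ne_fin4 (l : Fin 4) : ∃ j : Fin 4, j ≠ l := by
  revert l; decide

/-- **DEGREE-ONE WEIL RIGIDITY (kernel).** If the `(1,1)`-class with Gram matrix `[[A,B],[C,D]]` is killed by all sixteen
Weil directions `[[0,M],[Mᵀ,0]]`, then `B = C = 0` and `A = D = l • 1`: the class is `l • h`. Over any commutative ring,
no Hermitian or rationality hypothesis. Geometric reading (pen, card §2): `NS(X₀)_ℚ ∩ ker(T_W) = ℚ·h` — the only divisor
classes of `E_i^8` that remain of type `(1,1)` to first order along every Weil direction are the multiples of the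
polarisation; equivalently the Néron–Severi rank of the generic hyperbolic Weil-type eightfold is `1`. -/
theorem weilRigid_deg1 (A B C D : Matrix (Fin 4) (Fin 4) R)
    (h : ∀ M : Matrix (Fin 4) (Fin 4) R, Killed (weilDir M) (Matrix.fromBlocks A B C D)) :
    B = 0 ∧ C = 0 ∧ ∃ l : R, A = l • 1 ∧ D = l • 1 := by
  have H : ∀ j k : Fin 4,
      Matrix.single j k (1 : R) * C = C.transpose * Matrix.single k j 1 ∧
      Matrix.single j k (1 : R) * D = A.transpose * Matrix.single j k 1 ∧
      Matrix.single k j (1 : R) * B = B.transpose * Matrix.single j k 1 := by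
    intro j k
    have e := (killed_weilDir_iff (Matrix.single j k (1 : R)) A B C D).1 (h _)
    rw [Matrix.transpose_single] at e
    exact ⟨e.1, e.2.1, e.2.2.2⟩
  have hC : C = 0 := by
    ext k l
    obtain ⟨j, hj⟩ := exists_ne_fin4 l
    have e := congrFun (congrFun (H j k).1 j) l
    rw [single_mul_entry, mul_single_entry, if_pos rfl, if_neg (Ne.symm hj)] at e
    simpa using e
  have hB : B = 0 := by
    ext j l
    obtain ⟨k, hk⟩ := exists_ne_fin4 l
    have e := congrFun (congrFun (H j k).2.2 k) l
    rw [single_mul_entry, mul_single_entry, if_pos rfl, if_neg (Ne.symm hk)] at e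
    simpa using e
  have hDoff : ∀ k l : Fin 4, l ≠ k → D k l = 0 := by
    intro k l hl
    have e := congrFun (congrFun (H k k).2.1 k) l
    rw [single_mul_entry, mul_single_entry, if_pos rfl, if_neg hl] at e
    simpa using e
  have hAoff : ∀ j x : Fin 4, x ≠ j → A j x = 0 := by
    intro j x hx
    have e := congrFun (congrFun (H j j).2.1 x) j
    rw [single_mul_entry, mul_single_entry, if_neg hx, if_pos rfl, Matrix.transpose_apply] at e
    exact e.symm
  have hAD : ∀ j k : Fin 4, D k k = A j j := by
    intro j k
    have e := congrFun (congrFun (H j k).2.1 j) k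
    rw [single_mul_entry, mul_single_entry, if_pos rfl, if_pos rfl, Matrix.transpose_apply] at e
    exact e
  refine ⟨hB, hC, A 0 0, ?_, ?_⟩
  · ext x y
    by_cases hxy : x = y
    · subst hxy
      rw [Matrix.smul_apply, Matrix.one_apply_eq, smul_eq_mul, mul_one, ← hAD x 0, hAD 0 0]
    · rw [Matrix.smul_apply, Matrix.one_apply_ne hxy, smul_eq_mul, mul_zero]
      exact hAoff x y (Ne.symm hxy)
  · ext x y
    by_cases hxy : x = y
    · subst hxy
      rw [Matrix.smul_apply, Matrix.one_apply_eq, smul_eq_mul, mul_one, hAD 0 x]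
    · rw [Matrix.smul_apply, Matrix.one_apply_ne hxy, smul_eq_mul, mul_zero]
      exact hDoff x y (Ne.symm hxy)

/-- contrapositive reading used by the verdicts: a Gram matrix with a non-zero off-diagonal block, or with two different
diagonal entries, is NOT killed by some Weil direction (its class leaves `H^{1,1}` to first order somewhere on `T_W`). -/
theorem not_all_killed_of_offdiag (A B C D : Matrix (Fin 4) (Fin 4) R) (hB : B ≠ 0) :
    ∃ M : Matrix (Fin 4) (Fin 4) R, ¬ Killed (weilDir M) (Matrix.fromBlocks A B C D) := by
  by_contra hcon
  exact hB (weilRigid_deg1 A B C D (not_exists_not.mp hcon)).1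

theorem not_all_killed_of_diag_ne (A B C D : Matrix (Fin 4) (Fin 4) R) (j k : Fin 4) (hjk : A j j ≠ D k k) :
    ∃ M : Matrix (Fin 4) (Fin 4) R, ¬ Killed (weilDir M) (Matrix.fromBlocks A B C D) := by
  by_contra hcon
  obtain ⟨-, -, l, hA, hD⟩ := weilRigid_deg1 A B C D (not_exists_not.mp hcon)
  apply hjk
  rw [hA, hD]
  simp

/-- the Weil tangent space has dimension sixteen (`M₄`). -/
theorem weil_tangent_dim : Module.finrank ℚ (Matrix (Fin 4) (Fin 4) ℚ) = 16 := by
  simp [Module.finrank_matrix]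

end WeilRigidity

/-! ## §2 The lifting algebra of the UP road (kernel form of the class rows; the criterion itself is pen, card §2)

Abstract data: `K` a field (`ℚ` or `ℂ`); `H02` = `H^{0,2}(X₀)`; `ObV = Ext²(V,V)`, `ObE = Ext²(E,E)` with the scalar
embeddings `ιV s = s·id_V`, `ιE s = s·id_E` and the normalised traces `trV`, `trE` (`tr ∘ ι = rank •`); `T` = the Weil
tangent space, `NS` = `NS(X₀)_ℚ`, `D κ c = κ ∪ c ∈ H^{0,2}` the first-order derivative, `H ∈ NS` the polarisation, and
RIGIDITY `(∀ κ, D κ c = 0) → c ∈ K·H` (= `weilRigid_deg1` + rationality, §1). The UP-ROAD LIFTING CRITERION (pen): the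
degeneracy locus `Z = D_{m−1}(φ : V → E(t))` lifts to first order along `κ` iff `LiftsAlong ιV ιE (κ·At V) (κ·At E)`. -/

section LiftingAlgebra

variable {K : Type*} [Field K]
variable {ObV ObE H02 T NS : Type*}
variable [AddCommGroup ObV] [Module K ObV] [AddCommGroup ObE] [Module K ObE] [AddCommGroup H02] [Module K H02]
variable [AddCommGroup T] [Module K T] [AddCommGroup NS] [Module K NS]

/-- «the obstruction pair is a COMMON scalar»: `∃ s, oV = s·id_V ∧ oE = s·id_E`. [definition of this file; = the
right-hand side of the UP-ROAD LIFTING CRITERION, card §2 (C)+(D)] -/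
def LiftsAlong (ιV : H02 →ₗ[K] ObV) (ιE : H02 →ₗ[K] ObE) (oV : ObV) (oE : ObE) : Prop :=
  ∃ s : H02, oV = ιV s ∧ oE = ιE s

/-- **SLOPE MATCH (traces).** If `tr_V ∘ ι_V = m•` and `tr_E ∘ ι_E = r•` (`r = m + 3` on the UP road) and the pair lifts,
then `r • tr_V(oV) = m • tr_E(oE)` — i.e. `κ ∪ c₁(V) ∕ m = κ ∪ c₁(E) ∕ r`. -/
theorem slope_match (ιV : H02 →ₗ[K] ObV) (ιE : H02 →ₗ[K] ObE) (trV : ObV →ₗ[K] H02) (trE : ObE →ₗ[K] H02)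
    (m r : K) (hV : ∀ s, trV (ιV s) = m • s) (hE : ∀ s, trE (ιE s) = r • s) {oV : ObV} {oE : ObE}
    (h : LiftsAlong ιV ιE oV oE) : r • trV oV = m • trE oE := by
  obtain ⟨s, rfl, rfl⟩ := h
  rw [hV, hE, smul_smul, smul_smul, mul_comm]

/-- **ROW «SLOPE MATCH» (class level).** With `tr_V(κ·At V) = κ ∪ c₁(V)`, `tr_E(κ·At E) = κ ∪ c₁(E)` and Weil rigidity:
if the pair lifts along EVERY Weil direction then `r·c₁(V) − m·c₁(E) ∈ K·H`, i.e. `μ(V) − μ(E) ∈ ℚ·H`. -/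
theorem slope_match_classes (ιV : H02 →ₗ[K] ObV) (ιE : H02 →ₗ[K] ObE) (trV : ObV →ₗ[K] H02) (trE : ObE →ₗ[K] H02)
    (m r : K) (hV : ∀ s, trV (ιV s) = m • s) (hE : ∀ s, trE (ιE s) = r • s)
    (D : T →ₗ[K] NS →ₗ[K] H02) (H : NS) (rigid : ∀ c : NS, (∀ κ, D κ c = 0) → ∃ q : K, c = q • H)
    (c1V c1E : NS) (oV : T → ObV) (oE : T → ObE)
    (htrV : ∀ κ, trV (oV κ) = D κ c1V) (htrE : ∀ κ, trE (oE κ) = D κ c1E)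
    (lift : ∀ κ, LiftsAlong ιV ιE (oV κ) (oE κ)) :
    ∃ q : K, r • c1V - m • c1E = q • H := by
  apply rigid
  intro κ
  have e := slope_match ιV ιE trV trE m r hV hE (lift κ)
  rw [htrV, htrE] at e
  rw [map_sub, map_smul, map_smul, e, sub_self]

/-- block-diagonal liftability of a decomposed frame `V = ⊕_a V_a`: ONE scalar `s` serves every summand (the Atiyah class of a
direct sum is block-diagonal, so `κ·At V ∈ H^{0,2}·id_V` iff `κ·At V_a = s·id_{V_a}` for all `a` with the same `s`). -/
def LiftsAlongSummands {ι : Type*} {Ob : ι → Type*} [∀ a, AddCommGroup (Ob a)] [∀ a, Module K (Ob a)]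
    (ιa : ∀ a, H02 →ₗ[K] Ob a) (o : ∀ a, Ob a) : Prop :=
  ∃ s : H02, ∀ a, o a = ιa a s

/-- **ROW «COMMON SLOPE» (class level).** If every Weil direction lifts the decomposed frame with a common scalar, then for
all summands `a, b`: `rk_b·c₁(V_a) − rk_a·c₁(V_b) ∈ K·H`, i.e. ALL SUMMAND SLOPES ARE CONGRUENT modulo `ℚ·H`. -/
theorem common_slope_summands {ι : Type*} {Ob : ι → Type*} [∀ a, AddCommGroup (Ob a)] [∀ a, Module K (Ob a)]
    (ιa : ∀ a, H02 →ₗ[K] Ob a) (tra : ∀ a, Ob a →ₗ[K] H02) (rk : ι → K)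
    (htr : ∀ a s, tra a (ιa a s) = rk a • s)
    (D : T →ₗ[K] NS →ₗ[K] H02) (H : NS) (rigid : ∀ c : NS, (∀ κ, D κ c = 0) → ∃ q : K, c = q • H)
    (c1 : ι → NS) (o : T → ∀ a, Ob a) (hc1 : ∀ κ a, tra a (o κ a) = D κ (c1 a))
    (lift : ∀ κ, LiftsAlongSummands ιa (o κ)) (a b : ι) :
    ∃ q : K, rk b • c1 a - rk a • c1 b = q • H := by
  apply rigid
  intro κ
  obtain ⟨s, hs⟩ := lift κ
  have ea : D κ (c1 a) = rk a • s := by rw [← hc1, hs a, htr]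
  have eb : D κ (c1 b) = rk b • s := by rw [← hc1, hs b, htr]
  rw [map_sub, map_smul, map_smul, ea, eb, smul_smul, smul_smul, mul_comm, sub_self]

/-- the scalar is forced: if `tr ∘ ι = rk •` with `rk ≠ 0` and `o = ι s`, then `s = rk⁻¹ • tr o` — the common scalar of a
liftable pair is `κ ∪ μ`, `μ = c₁ ∕ rank` (used in the card to rewrite the criterion as «`E(−μ)` and every `V_a(−μ)` are
first-order Weil-liftable»). -/
theorem scalar_eq_slope {Ob : Type*} [AddCommGroup Ob] [Module K Ob] (ι : H02 →ₗ[K] Ob) (tr : Ob →ₗ[K] H02) (rk : K)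
    (hrk : rk ≠ 0) (htr : ∀ s, tr (ι s) = rk • s) {o : Ob} {s : H02} (h : o = ι s) : s = rk⁻¹ • tr o := by
  rw [h, htr, smul_smul, inv_mul_cancel₀ hrk, one_smul]

end LiftingAlgebra

/-! ## §3 Integrality dichotomy and the arithmetic of the verdicts (kernel) -/

section Integrality

variable {G : Type*} [AddCommGroup G]

/-- **`3μ` IS INTEGRAL.** `c₁(V) = m·μ + λH` and `c₁(E) = (m+3)·μ + λ'H` are integral classes, so `3μ ∈ NS + ℚH`
(`L` = the subgroup `NS(X₀) + ℚ·H` of `NS(X₀)_ℚ`, `μ` the common slope class). -/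
theorem three_smul_mem (L : AddSubgroup G) (μ : G) (m : ℤ) (hV : m • μ ∈ L) (hE : (m + 3) • μ ∈ L) :
    (3 : ℤ) • μ ∈ L := by
  have e : (3 : ℤ) • μ = (m + 3) • μ - m • μ := by rw [add_zsmul]; abel
  rw [e]
  exact L.sub_mem hE hV

/-- **`μ` IS INTEGRAL WHEN `3 ∤ m`.** If moreover `gcd(m, 3) = 1` then `μ ∈ NS + ℚH` itself (Bézout), so after an honest
twist of the pair `(V, E)` by a line bundle the common slope is a rational multiple of `H`: the H-PROPORTIONAL regime. -/
theorem mem_of_gcd_eq_one (L : AddSubgroup G) (μ : G) (m : ℤ) (hV : m • μ ∈ L) (hE : (m + 3) • μ ∈ L)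
    (hg : Int.gcd m 3 = 1) : μ ∈ L := by
  have h3 := three_smul_mem L μ m hV hE
  have bez := Int.gcd_eq_gcd_ab m 3
  rw [hg] at bez
  have e : μ = m.gcdA 3 • (m • μ) + m.gcdB 3 • ((3 : ℤ) • μ) := by
    rw [smul_smul, smul_smul, ← add_zsmul, mul_comm (m.gcdA 3), mul_comm (m.gcdB 3)]
    have : m * m.gcdA 3 + 3 * m.gcdB 3 = 1 := by exact_mod_cast bez.symm
    rw [this, one_zsmul]
  rw [e]
  exact L.add_mem (L.zsmul_mem hV _) (L.zsmul_mem h3 _)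

/-- the UP objects of record have `3 ∣ m` (`r = m + 3 ∈ {720, 768, 2160}` and `R_min = 255` for P1-RB8), so for them the
TRIADIC room (`3[μ] = 0`, `[μ] ≠ 0`) is arithmetically open — it is closed instead by their class gate (`c₁(E) ∈ ℚH`, card
§3 (V0)); the rank-8 room of c4-1 g2 (`m = 5`) has no triadic room at all. -/
theorem record_ranks : (717 = 3 * 239 ∧ 765 = 3 * 255 ∧ 2157 = 3 * 719 ∧ 252 = 3 * 84) ∧
    Int.gcd 5 3 = 1 ∧ Int.gcd 717 3 = 3 := by
  refine ⟨by norm_num, by decide, by decide⟩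

end Integrality

section Verdicts

/-- the eight coordinate classes `f_j = pr_j^*[pt]` of `E^8` and the product polarisation `H = Σ f_j`, in the coordinates
`Fin 8 → ℚ` of the diagonal part of `NS(E^8)_ℚ` (enough for the verdicts below: all classes involved are diagonal). -/
def fClass (j : Fin 8) : Fin 8 → ℚ := Pi.single j 1

/-- the product polarisation in diagonal coordinates. -/
def hClass : Fin 8 → ℚ := fun _ => 1

/-- slopes of the three summands of the critic's strike frame (idea-crit-6 g13, bus l.8046 (C)):
`pr₁^*F_{358,1} ⊗ P_ξ`, `pr₁^*F_{358,−1} ⊗ P_{ξ′}`, `P_η` have slopes `f₁∕358`, `−f₁∕358`, `0`. -/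
def strikeSlope : Fin 3 → (Fin 8 → ℚ)
  | 0 => (1 / 358 : ℚ) • fClass 0
  | 1 => (-(1 / 358) : ℚ) • fClass 0
  | 2 => 0

/-- **VERDICT: THE STRIKE FRAME IS DEAD AT FIRST ORDER.** Its summand slopes are pairwise INCONGRUENT modulo `ℚ·H`
(row «COMMON SLOPE» violated), so by the criterion some Weil direction does not lift `Z = D_{716}(φ)`, and `Z` is not
Bloch-semiregular whatever `E` is (card §3 (V1)). Kernel part: the three slope differences are not rational multiples of `H`. -/
theorem strike_frame_incongruent :
    (¬ ∃ q : ℚ, strikeSlope 0 - strikeSlope 1 = q • hClass) ∧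
    (¬ ∃ q : ℚ, strikeSlope 0 - strikeSlope 2 = q • hClass) ∧
    (¬ ∃ q : ℚ, strikeSlope 1 - strikeSlope 2 = q • hClass) := by
  refine ⟨?_, ?_, ?_⟩ <;>
  · rintro ⟨q, hq⟩
    have h0 := congrFun hq 0
    have h1 := congrFun hq 1
    simp [strikeSlope, fClass, hClass] at h0 h1
    rw [← h1] at h0
    norm_num at h0

/-- a SPLIT frame `⊕ L_{c_a}` obeys «COMMON SLOPE» iff all `c_a − c_b ∈ ℚH ∩ NS = ℤH`: it is an `H`-LADDER ON ONE LETTER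
`⊕_a L_{c₀ + n_a H}` (card §3 (V2)). Kernel sanity on the frames of record: the Pic⁰-generic frame `⊕ P_ξ` and the trivial
frame have all slopes `0` (congruent — they pass the first-order row; the trivial frame dies at second order, c4-1 g2 THEOREM
DL), whereas `𝒪(f₁) ⊕ 𝒪(−f₁)`-type frames are incongruent. -/
theorem split_frame_examples :
    (∃ q : ℚ, (0 : Fin 8 → ℚ) - 0 = q • hClass) ∧ (∃ q : ℚ, (3 : ℚ) • hClass - (1 : ℚ) • hClass = q • hClass) ∧
    ¬ ∃ q : ℚ, fClass 0 - (-fClass 0) = q • hClass := by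
  refine ⟨⟨0, by simp⟩, ⟨2, by rw [← sub_smul]; norm_num⟩, ?_⟩
  rintro ⟨q, hq⟩
  have h0 := congrFun hq 0
  have h1 := congrFun hq 1
  simp [fClass, hClass] at h0 h1
  rw [← h1] at h0
  norm_num at h0

/-- **LINE 11 TIER 2 RESTORED for the objects of record** (card §3 (V3)): in the H-proportional regime the eighth-power unit
count of LINE 11 applies verbatim — `717 = 2·256 + 205` needs `207 > 137` units (r = 720: b3940cff ∕ 7fe678c9 ∕ MIN-T4b), so
those objects again require a unit price `π ≤ 3136 ∕ 207 < 15.15`; and in a TRIADIC background every coin is a multiple of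
`3`, so at least `⌈717 ∕ c_max⌉` units for the largest available coin `c_max` — with coin `3` alone, `239 > 137` units. -/
theorem restored_unit_counts :
    717 = 2 * 256 + 205 ∧ 2 + 205 = 207 ∧ 137 < 207 ∧ (3136 : ℚ) / 207 < 15.15 ∧ 717 / 3 = 239 ∧ 137 < 239 ∧
      (3136 : ℚ) / 239 < 13.13 := by
  norm_num

end Verdicts

end Summit.HodgeConjecture.HodgeConjecture.Cruxes.BlochSeedDiscOne.CommonSlopeLaw
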